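import Summits.BirchSwinnertonDyer.BirchSwinnertonDyer.Theorems.SchneiderFreeAdditiveX3Defs
import Summits.BirchSwinnertonDyer.Rank1Residual.O6.X4CongruenceAnchor
import Literature.NumberTheory.EllipticCurves.BurungaleCastellaSkinner2025.BDPMainConjecture
import HarnessLib

/-!
# Route `UniversalToricDescent`, crux #3 `TwinSplitIMCAtThree` and its bucket-C child (item
# stmt-BirchSwinnertonDyer-20695): the POINTWISE twin IMC and the `a₃ = 0`-twin predicates, NAMED
# (predicates on a curve; definitions only, nothing asserted)

Cell `bsd-wall` (W-ALL lane 3, row 2·3@3), seat `bsd-wall-utd-p2` g6, 2026-08-27. The twin-choice kernel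
(`UniversalToricDescentTwinChoiceKernelAtThree.lean`, p576995) shows that the route's kernel consumes crux #3
only at the ONE twin handed over by the leaf, at Heegner fields with `d_K` odd, and that bucket C's child may
be restricted to twins with `a₃ = 0` granted a supply statement — all displayed there INLINE. This file names
the predicates involved (each a predicate ON A CURVE, so that pointwise / class-wise statements can be written
by name; D-0014: a prover files no statement items; nothing is asserted here):

* `TwinIMCAtThreeAt W′` — crux #3's conclusion for THE curve `W′`: for every level `N′ = N(W′)`, every
  imaginary quadratic Heegner field `K` for `N′` with `d_K` ODD, every anticyclotomic `κ`, generator `γ`,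
  degree-one `𝔭 ∋ 3`, other prime `𝔭′ ≠ 𝔭`, and `ι′` inducing `𝔭`: `(i)` a BDP frame for `f_{W′}` exists
  and `(ii)` `Ch_Λ(X_ac(W′/K_∞) strict at 𝔭′)·R₀⟦T⟧ = (L′)` at every frame. (Item 20695 is
  `∀ W′, GoodSS W′ 3 → ρ̄₃ onto → TwinIMCAtThreeAt W′` up to the order of binders; its `a₃ = 0` half is
  `∀ W′, GoodSS W′ 3 → W′.frobeniusTrace 3 = 0 → ρ̄₃ onto → TwinIMCAtThreeAt W′` — see
  `UniversalToricDescentTwinChoiceByName.lean`.)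
* `HasGoodSSTwinAtThree W` / `HasGoodSSApZeroTwinAtThree W` — `W` has a `Γ_ℚ`-equivariantly
  `3`-congruent twin (globally minimal model) with good supersingular reduction at `3` / with, moreover,
  `a₃ = 0`. The SUPPLY statement of p576995 §3 is `∀ W, HasGoodSSTwinAtThree W → HasGoodSSApZeroTwinAtThree W`
  (census TWIN-PRINT-AT3-v1 §2: an `a₃ = 0` twin is witnessed in 603/603 bucket-C classes; on paper all
  good-supersingular curves over `ℚ₃` share one local `3`-torsion type, realised with either symplectic
  sign by `y² = x³ − x` and its `2`-isogenous curve, and `X_E(3) ≅ ℙ¹` has the weak-approximation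
  property — memo HOME/bsd-wall-utd-p2/SUPSET-AT3-v9.md §2).

HONEST FRAMING: definitions only; nothing closes; BSD is not proved for any curve here. Route-free imports
(no `Theses` module), so that files on and off the route cone can share these names.
-/

set_option autoImplicit false
set_option linter.dupNamespace false

noncomputable section

open scoped Classical

namespace Summit.BirchSwinnertonDyer.BirchSwinnertonDyer.Theorems.UniversalToricDescentTwinChoice

open WeierstrassCurve NumberField IsDedekindDomain Field
  Literature.NumberTheory.EllipticCurves
  Literature.NumberTheory.EllipticCurves.ModularForms
  Literature.NumberTheory.EllipticCurves.Rank1Residual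
  Summit.BirchSwinnertonDyer.Rank1Residual
  Summit.BirchSwinnertonDyer.Rank1Residual.X11b
  Summit.BirchSwinnertonDyer.Rank1Residual.X11b.AcSelmer
  Summit.BirchSwinnertonDyer.Rank1Residual.X11b.Halves
  Summit.BirchSwinnertonDyer.BirchSwinnertonDyer.Theorems

/-- **Crux #3's conclusion at ONE curve `W′`** (the twin IMC, pointwise): for every `N′` with
`N(W′) = N′`, every imaginary quadratic `K` with the classical Heegner hypothesis for `N′` and `d_K` odd,
every anticyclotomic `ℤ₃`-extension `κ` with topological generator `γ`, degree-one prime `𝔭 ∋ 3`, prime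
`𝔭′ ∋ 3` with `𝔭′ ≠ 𝔭`, and `ι′ : ℂ₃ ≃ ℂ` inducing `𝔭`: `(i)` a BDP frame `(Ω_K, Ω_p, L′)` for `f_{W′}`
exists and `(ii)` for every such frame `Ch_Λ(X_ac(W′/K) strict at 𝔭′)·R₀⟦T⟧ = (L′)`. The hypothesis the
twin-choice kernel `bsdp_three_of_twinIMCAt` consumes at the handed twin. A predicate on `W′`; nothing
asserted. [folklore] -/
def TwinIMCAtThreeAt (W' : WeierstrassCurve ℚ) [W'.IsElliptic] [W'.IsGloballyMinimal] : Prop :=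
  ∀ (N' : ℕ) [NeZero N'] (K : Type) [Field K] [NumberField K]
    (Dt' : ModularParametrizationData W' N'), W'.conductorNorm ℤ = N' → IsImaginaryQuadratic K →
    SatisfiesHeegnerHypothesis N' K → Odd (NumberField.discr K) →
    ∀ (κ : ZpExtension K 3), κ.IsAnticyclotomic →
    ∀ (γ : absoluteGaloisGroup K) [Fact (κ.IsTopGenerator γ)] (𝔭 : HeightOneSpectrum (𝓞 K)),
      ((3 : ℕ) : 𝓞 K) ∈ 𝔭.asIdeal → 𝔭.asIdeal.ramificationIdx (𝓞 ℚ) = 1 →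
      𝔭.asIdeal.inertiaDeg (𝓞 ℚ) = 1 →
    ∀ (𝔭' : HeightOneSpectrum (𝓞 K)), ((3 : ℕ) : 𝓞 K) ∈ 𝔭'.asIdeal → 𝔭' ≠ 𝔭 →
    ∀ (ι' : PadicAlgCl 3 ≃+* ℂ), SchneiderFree.BranchInducesPrime 3 ι' 𝔭 →
      (∃ (ΩK : ℂ) (Ωp : ℂ_[3]) (L' : UnrSeries 3), ΩK ≠ 0 ∧ Ωp ≠ 0 ∧
        IsBDPLFunction ι' 𝔭 κ γ Dt'.f ΩK Ωp L') ∧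
      (∀ (ΩK : ℂ) (Ωp : ℂ_[3]) (L' : UnrSeries 3), ΩK ≠ 0 → Ωp ≠ 0 →
        IsBDPLFunction ι' 𝔭 κ γ Dt'.f ΩK Ωp L' →
        (XAc.charIdeal (W'.baseChange K) 3 κ 𝔭' ∅ γ).map (PowerSeries.map (toUnr 3)) =
          Ideal.span {L'})

/-- **`W` has a good-supersingular-at-`3` twin**: some elliptic curve over `ℚ` (globally minimal model
`W′`) with `W′[3] ≃ W[3]` `Γ_ℚ`-equivariantly (`O6.ModPCongruent W′ W 3`) has good reduction at `3` with
`3 ∣ a₃` (`GoodSS W′ 3`). A predicate on `W`; nothing asserted. [folklore] -/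
def HasGoodSSTwinAtThree (W : WeierstrassCurve ℚ) [W.IsElliptic] : Prop :=
  ∃ (W' : WeierstrassCurve ℚ) (_ : W'.IsElliptic) (_ : W'.IsGloballyMinimal),
    O6.ModPCongruent W' W 3 ∧ GoodSS W' 3

/-- **`W` has a good-supersingular-at-`3` twin with `a₃ = 0`**: as `HasGoodSSTwinAtThree`, with moreover
`W′.frobeniusTrace 3 = 0`. A predicate on `W`; nothing asserted. [folklore] -/
def HasGoodSSApZeroTwinAtThree (W : WeierstrassCurve ℚ) [W.IsElliptic] : Prop :=
  ∃ (W' : WeierstrassCurve ℚ) (_ : W'.IsElliptic) (_ : W'.IsGloballyMinimal),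
    O6.ModPCongruent W' W 3 ∧ GoodSS W' 3 ∧ W'.frobeniusTrace 3 = 0

/-- The `a₃ = 0` twin is in particular a good-supersingular twin. [folklore] -/
theorem HasGoodSSApZeroTwinAtThree.hasGoodSSTwinAtThree {W : WeierstrassCurve ℚ} [W.IsElliptic]
    (h : HasGoodSSApZeroTwinAtThree W) : HasGoodSSTwinAtThree W := by
  obtain ⟨W', hW'e, hW'm, hc, hss, -⟩ := h
  exact ⟨W', hW'e, hW'm, hc, hss⟩

end Summit.BirchSwinnertonDyer.BirchSwinnertonDyer.Theorems.UniversalToricDescentTwinChoice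

end
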